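import Summits.ABC.Harvest.OpenQuestions
import Mathlib.RingTheory.Radical.NatInt
import HarnessLib

/-!
# ABC harvest — glue G-21: Smirnov's Hurwitz inequality over `F₁` ⟺ abc (row H-402, door C8)

`Summits/ABC/Harvest/GlueSmirnov.lean` — cell `abc-harv`, seat abc-harv-pr-3 (KEY GLUE-CALIB, re-pointed to
G-20/G-21 by director-abc g6 2026-08-27T16:45:28Z), namespace `Summit.ABC.Harvest`. PROOF-ONLY companion
of `OpenQuestions.lean` §9 (`smirnovDefect`, `SmirnovHurwitzInequality`: Smirnov 1992 as transcribed by
Jarra arXiv:2306.16637 pp. 1–2, `q = a/b ∈ (0,1)`). Content (REF-B = abc-harv ref-2, scratch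
`lanes/ref-2/Glue_Smirnov_iff_ABC.lean` 2026-08-27T16:49Z, adapted to the LITERAL fibre-by-fibre defect):

* §A radical bookkeeping in `ℕ` (`Σ_{p∣n}(v_p−1) log p = log n − log rad n`, subadditivity of `log rad`);
* §B the two closed-form bounds for `smirnovDefect a b` (LOWER: drop the fibre over `[2]`; UPPER: on that
  fibre `v_p(b² − a²) = v_p(a+b)` because `p ∤ b − a`);
* §C **Smirnov ⟹ abc** (`abc_of_smirnovHurwitzInequality`): for a triple `x + y = z`, `x ≤ y`, apply the
  inequality to `q = x/z` (the fibre over `[1]` is the primes of `z − x = y`), get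
  `log y ≤ ε' log z + log rad(xyz) + C + 1`, `z ≤ 2y`, `ε' = ε/(1+ε)` — this is the direction of Smirnov's
  printed Theorem, here a 40-line elementary argument under the transcription (REF-B used `q = x/y`; `q = x/z`
  avoids the `2`-adic bookkeeping of the `[2]`-fibre);
* §D **abc ⟹ Smirnov** (`smirnovHurwitzInequality_of_abc`, NOT in print): abc with `ε/6` on
  `(a², b² − a², b²)` gives the valuation form `log(b−a) + log(a+b) ≤ ε log b + Σ log rad + C` (REF-B), and
  the UPPER closed form converts it into `Σ δ ≤ 2 + ε + (C−1)/log b`;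
* `smirnovHurwitzInequality_iff_abc`: door C8 is a RESTATEMENT of the summit (rung A0).

HONESTY (D-0139/D-0140): abc is not proved by any of this — an open conjecture is shown EQUIVALENT to abc;
typed ≠ proved; the transcription rests on the secondary (Jarra 2023) while the primary [Smi93] is not held
(acq-13177); no side taken on anything else. No `sorry`, no new axiom, no `def`.
-/

noncomputable section

open Literature.NumberTheory.DiophantineGeometry UniqueFactorizationMonoid Finset

namespace Summit.ABC.Harvest

namespace Smirnov

/-! ### A. Radical bookkeeping in `ℕ` -/

/-- `Σ_{p ∣ n} (v_p(n) − 1)·log p = log n − log rad n` for `n ≠ 0`. [folklore] -/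
theorem sum_primeFactors_factorization_sub_one_mul_log {n : ℕ} (hn : n ≠ 0) :
    ∑ p ∈ n.primeFactors, ((n.factorization p : ℝ) - 1) * Real.log p =
      Real.log (n : ℝ) - Real.log ((radical n : ℕ) : ℝ) := by
  have h1 : Real.log (n : ℝ) = ∑ p ∈ n.primeFactors, (n.factorization p : ℝ) * Real.log p := by
    conv_lhs => rw [Nat.prod_primeFactors_pow_factorization hn]
    push_cast
    rw [Real.log_prod]
    · exact Finset.sum_congr rfl fun p _ => by rw [Real.log_pow]
    · intro p hp
      exact pow_ne_zero _ (by exact_mod_cast (Nat.prime_of_mem_primeFactors hp).ne_zero)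
  have h2 : Real.log ((radical n : ℕ) : ℝ) = ∑ p ∈ n.primeFactors, Real.log (p : ℝ) := by
    rw [Nat.radical_eq_prod_primeFactors]
    push_cast
    exact Real.log_prod (fun p hp => by exact_mod_cast (Nat.prime_of_mem_primeFactors hp).ne_zero)
  rw [h1, h2, ← Finset.sum_sub_distrib]
  exact Finset.sum_congr rfl fun p _ => by ring

/-- `log rad(mn) ≤ log rad m + log rad n`. [folklore] -/
theorem log_radical_mul_le (m n : ℕ) :
    Real.log ((radical (m * n) : ℕ) : ℝ) ≤
      Real.log ((radical m : ℕ) : ℝ) + Real.log ((radical n : ℕ) : ℝ) := by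
  have h := Nat.le_of_dvd (Nat.mul_pos (Nat.radical_pos m) (Nat.radical_pos n))
    (radical_mul_dvd (a := m) (b := n))
  rw [← Real.log_mul (by exact_mod_cast (Nat.radical_pos m).ne')
    (by exact_mod_cast (Nat.radical_pos n).ne')]
  exact Real.log_le_log (by exact_mod_cast Nat.radical_pos _) (by exact_mod_cast h)

/-- `rad(xyz) = rad x · rad y · rad z` for pairwise coprime naturals. [folklore] -/
theorem radical_mul_three_of_coprime {x y z : ℕ} (hxy : Nat.Coprime x y) (hxz : Nat.Coprime x z)
    (hyz : Nat.Coprime y z) : radical (x * y * z) = radical x * radical y * radical z := by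
  rw [radical_mul (Nat.coprime_iff_isRelPrime.mp (Nat.Coprime.mul_left hxz hyz)),
    radical_mul (Nat.coprime_iff_isRelPrime.mp hxy)]

/-- `log rad x + log rad y + log rad z = log rad(xyz)` for an abc triple. [folklore] -/
theorem log_radical_add_three {x y z : ℕ} (hxyz : x + y = z) (hcop : Nat.Coprime x y) :
    Real.log ((radical x : ℕ) : ℝ) + Real.log ((radical y : ℕ) : ℝ) +
      Real.log ((radical z : ℕ) : ℝ) = Real.log ((radical (x * y * z) : ℕ) : ℝ) := by
  have hxz : Nat.Coprime x z := by rw [← hxyz]; exact Nat.coprime_self_add_right.mpr hcop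
  have hyz : Nat.Coprime y z := by rw [← hxyz]; exact Nat.coprime_add_self_right.mpr hcop.symm
  rw [radical_mul_three_of_coprime hcop hxz hyz, Nat.cast_mul, Nat.cast_mul,
    Real.log_mul (by positivity) (by exact_mod_cast (Nat.radical_pos z).ne'),
    Real.log_mul (by exact_mod_cast (Nat.radical_pos x).ne') (by exact_mod_cast (Nat.radical_pos y).ne')]

/-! ### B. Closed-form bounds for Smirnov's defect -/

/-- LOWER bound: dropping the fibre over `[2]` (each of its terms is `≥ 0`),
`(log a − log rad a) + (log b − log rad b) + (log(b−a) − log rad(b−a)) + (log(b/a) − 1) ≤ smirnovDefect a b`.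
[folklore] -/
theorem closedForm_le_smirnovDefect {a b : ℕ} (ha : 0 < a) (hab : a < b) :
    (Real.log (a : ℝ) - Real.log ((radical a : ℕ) : ℝ))
      + (Real.log (b : ℝ) - Real.log ((radical b : ℕ) : ℝ))
      + (Real.log ((b - a : ℕ) : ℝ) - Real.log ((radical (b - a) : ℕ) : ℝ))
      + (Real.log ((b : ℝ) / a) - 1) ≤ smirnovDefect a b := by
  unfold smirnovDefect
  rw [sum_primeFactors_factorization_sub_one_mul_log ha.ne',
    sum_primeFactors_factorization_sub_one_mul_log (by omega : b ≠ 0),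
    sum_primeFactors_factorization_sub_one_mul_log (by omega : b - a ≠ 0)]
  have h4 : 0 ≤ ∑ p ∈ (a + b).primeFactors with ¬ p ∣ (b - a),
      (((b ^ 2 - a ^ 2).factorization p : ℝ) - 1) * Real.log p := by
    refine Finset.sum_nonneg fun p hp => ?_
    rw [Finset.mem_filter] at hp
    have hpp : p.Prime := Nat.prime_of_mem_primeFactors hp.1
    have hne : b ^ 2 - a ^ 2 ≠ 0 := (Nat.sub_pos_of_lt (Nat.pow_lt_pow_left hab two_ne_zero)).ne'
    have hdvd2 : p ∣ b ^ 2 - a ^ 2 := by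
      rw [Nat.sq_sub_sq]
      exact Dvd.dvd.mul_right (by rw [add_comm]; exact Nat.dvd_of_mem_primeFactors hp.1) _
    have h1 : (1 : ℝ) ≤ (b ^ 2 - a ^ 2).factorization p := by
      exact_mod_cast (hpp.dvd_iff_one_le_factorization hne).mp hdvd2
    have hlog : 0 ≤ Real.log (p : ℝ) := Real.log_nonneg (by exact_mod_cast hpp.one_lt.le)
    nlinarith
  linarith

/-- UPPER bound: on the fibre over `[2]` one has `v_p(b² − a²) = v_p(a+b)` (`p ∤ b − a`), and the omitted
primes of `a + b` contribute `≥ 0`, so `smirnovDefect a b ≤` the four closed forms `+ (log(b/a) − 1)`.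
[folklore] -/
theorem smirnovDefect_le_closedForm {a b : ℕ} (ha : 0 < a) (hab : a < b) :
    smirnovDefect a b ≤
      (Real.log (a : ℝ) - Real.log ((radical a : ℕ) : ℝ))
      + (Real.log (b : ℝ) - Real.log ((radical b : ℕ) : ℝ))
      + (Real.log ((b - a : ℕ) : ℝ) - Real.log ((radical (b - a) : ℕ) : ℝ))
      + (Real.log ((a + b : ℕ) : ℝ) - Real.log ((radical (a + b) : ℕ) : ℝ))
      + (Real.log ((b : ℝ) / a) - 1) := by
  unfold smirnovDefect
  rw [sum_primeFactors_factorization_sub_one_mul_log ha.ne',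
    sum_primeFactors_factorization_sub_one_mul_log (by omega : b ≠ 0),
    sum_primeFactors_factorization_sub_one_mul_log (by omega : b - a ≠ 0),
    ← sum_primeFactors_factorization_sub_one_mul_log (by omega : a + b ≠ 0)]
  have h4 : ∑ p ∈ (a + b).primeFactors with ¬ p ∣ (b - a),
      (((b ^ 2 - a ^ 2).factorization p : ℝ) - 1) * Real.log p ≤
      ∑ p ∈ (a + b).primeFactors, (((a + b).factorization p : ℝ) - 1) * Real.log p := by
    calc ∑ p ∈ (a + b).primeFactors with ¬ p ∣ (b - a),
          (((b ^ 2 - a ^ 2).factorization p : ℝ) - 1) * Real.log p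
        = ∑ p ∈ (a + b).primeFactors with ¬ p ∣ (b - a),
          (((a + b).factorization p : ℝ) - 1) * Real.log p := by
          refine Finset.sum_congr rfl fun p hp => ?_
          rw [Finset.mem_filter] at hp
          have hfac : (b ^ 2 - a ^ 2).factorization p = (a + b).factorization p := by
            rw [Nat.sq_sub_sq, add_comm b a, Nat.factorization_mul (by omega) (by omega),
              Finsupp.add_apply, Nat.factorization_eq_zero_of_not_dvd hp.2, add_zero]
          rw [hfac]
      _ ≤ ∑ p ∈ (a + b).primeFactors, (((a + b).factorization p : ℝ) - 1) * Real.log p := by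
          apply Finset.sum_le_sum_of_subset_of_nonneg (Finset.filter_subset _ _)
          intro p hp _
          have hpp : p.Prime := Nat.prime_of_mem_primeFactors hp
          have h1 : (1 : ℝ) ≤ (a + b).factorization p := by
            exact_mod_cast (hpp.dvd_iff_one_le_factorization (by omega)).mp
              (Nat.dvd_of_mem_primeFactors hp)
          have hlog : 0 ≤ Real.log (p : ℝ) := Real.log_nonneg (by exact_mod_cast hpp.one_lt.le)
          nlinarith
  linarith

/-! ### C. Smirnov ⟹ abc -/

/-- Multiplying the conjectured inequality out by `deg(φ_q) = log b` and using the LOWER closed form: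
for coprime `0 < a < b`, `log(b − a) ≤ ε'·log b + log rad a + log rad b + log rad(b − a) + C + 1`.
[folklore] -/
theorem log_sub_le_of_smirnov {ε' C : ℝ}
    (hS : ∀ a b : ℕ, 0 < a → a < b → Nat.Coprime a b →
      smirnovDefect a b / Real.log b ≤ 2 + ε' + C / Real.log b)
    {a b : ℕ} (ha : 0 < a) (hab : a < b) (hcop : Nat.Coprime a b) :
    Real.log ((b - a : ℕ) : ℝ) ≤ ε' * Real.log (b : ℝ) + Real.log ((radical a : ℕ) : ℝ)
      + Real.log ((radical b : ℕ) : ℝ) + Real.log ((radical (b - a) : ℕ) : ℝ) + C + 1 := by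
  have hb1 : (1 : ℝ) < b := by exact_mod_cast (show 1 < b by omega)
  have hlogb : 0 < Real.log (b : ℝ) := Real.log_pos hb1
  have hL : Real.log (b : ℝ) ≠ 0 := hlogb.ne'
  have h := (div_le_iff₀ hlogb).mp (hS a b ha hab hcop)
  have hmul : (2 + ε' + C / Real.log (b : ℝ)) * Real.log (b : ℝ) = (2 + ε') * Real.log (b : ℝ) + C := by
    field_simp
  rw [hmul] at h
  have hlow := closedForm_le_smirnovDefect ha hab
  have hlogdiv : Real.log ((b : ℝ) / a) = Real.log (b : ℝ) - Real.log (a : ℝ) :=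
    Real.log_div (by exact_mod_cast (show b ≠ 0 by omega)) (by exact_mod_cast ha.ne')
  linarith

/-- For an abc triple `x + y = z` with `x ≤ y`, the conjecture at `ε'` applied to `q = x/z` (fibre over
`[1]` = primes of `z − x = y`): `log z ≤ log 2 + ε'·log z + log rad(xyz) + C + 1`. [folklore] -/
theorem log_le_of_smirnov {ε' C : ℝ}
    (hS : ∀ a b : ℕ, 0 < a → a < b → Nat.Coprime a b →
      smirnovDefect a b / Real.log b ≤ 2 + ε' + C / Real.log b)
    {x y z : ℕ} (hx : 0 < x) (hy : 0 < y) (hxyz : x + y = z) (hcop : Nat.Coprime x y) (hxy : x ≤ y) :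
    Real.log (z : ℝ) ≤ Real.log 2 + ε' * Real.log (z : ℝ)
      + Real.log ((radical (x * y * z) : ℕ) : ℝ) + C + 1 := by
  have hxz : x < z := by omega
  have hcopxz : Nat.Coprime x z := by rw [← hxyz]; exact Nat.coprime_self_add_right.mpr hcop
  have h := log_sub_le_of_smirnov hS hx hxz hcopxz
  rw [(by omega : z - x = y)] at h
  have h2 : Real.log (z : ℝ) ≤ Real.log 2 + Real.log (y : ℝ) := by
    rw [← Real.log_mul two_ne_zero (by exact_mod_cast hy.ne')]
    exact Real.log_le_log (by exact_mod_cast (show 0 < z by omega))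
      (by exact_mod_cast (show z ≤ 2 * y by omega))
  have hrad := log_radical_add_three hxyz hcop
  linarith

end Smirnov

open Smirnov in
/-- **Smirnov ⟹ abc** (row H-402, G-21, direction of Smirnov's 1992 Theorem; elementary under the Jarra
transcription, REF-B 2026-08-27): with `ε' = ε/(1+ε)`, `log z ≤ (1+ε)(log rad(xyz) + C + 1 + log 2)`.
abc is not proved by this: the hypothesis is an open conjecture equivalent to abc. [folklore] -/
theorem abc_of_smirnovHurwitzInequality (h : SmirnovHurwitzInequality) : _root_.ABC := by
  rw [ABC_iff]
  intro ε hε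
  obtain ⟨C, hC⟩ := h (ε / (1 + ε)) (by positivity)
  refine ⟨Real.exp ((1 + ε) * (C + 1 + Real.log 2)) + 1, by positivity, ?_⟩
  rintro x y z ⟨hx, hy, hxyz, hcop⟩
  rw [rad_def]
  set R : ℝ := ((radical (x * y * z) : ℕ) : ℝ) with hR
  have hRpos : 0 < R := by rw [hR]; exact_mod_cast Nat.radical_pos _
  have hz : (0 : ℝ) < z := by exact_mod_cast (show 0 < z by omega)
  have key : Real.log (z : ℝ) ≤ Real.log 2 + ε / (1 + ε) * Real.log (z : ℝ) + Real.log R + C + 1 := by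
    rcases le_total x y with hxy | hyx
    · exact log_le_of_smirnov hC hx hy hxyz hcop hxy
    · have := log_le_of_smirnov hC hy hx (by omega : y + x = z) hcop.symm hyx
      rwa [show y * x * z = x * y * z by ring] at this
  have h3 : Real.log (z : ℝ) ≤ (1 + ε) * (Real.log R + (C + 1 + Real.log 2)) := by
    have h4 : (1 - ε / (1 + ε)) * Real.log (z : ℝ) ≤ Real.log R + (C + 1 + Real.log 2) := by linarith
    have h5 : (1 - ε / (1 + ε)) = 1 / (1 + ε) := by field_simp; ring
    rw [h5] at h4
    have h6 := mul_le_mul_of_nonneg_left h4 (by positivity : (0 : ℝ) ≤ 1 + ε)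
    calc Real.log (z : ℝ) = (1 + ε) * (1 / (1 + ε) * Real.log (z : ℝ)) := by field_simp
      _ ≤ (1 + ε) * (Real.log R + (C + 1 + Real.log 2)) := h6
  have hzle : (z : ℝ) ≤ Real.exp ((1 + ε) * (C + 1 + Real.log 2)) * R ^ (1 + ε) := by
    calc (z : ℝ) = Real.exp (Real.log z) := (Real.exp_log hz).symm
      _ ≤ Real.exp ((1 + ε) * (Real.log R + (C + 1 + Real.log 2))) := Real.exp_le_exp.mpr h3
      _ = Real.exp ((1 + ε) * (C + 1 + Real.log 2)) * R ^ (1 + ε) := by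
        rw [Real.rpow_def_of_pos hRpos, ← Real.exp_add]; congr 1; ring
  have hRge : (0 : ℝ) < R ^ (1 + ε) := Real.rpow_pos_of_pos hRpos _
  nlinarith [Real.exp_pos ((1 + ε) * (C + 1 + Real.log 2))]

/-! ### D. abc ⟹ Smirnov -/

namespace Smirnov

/-- **abc ⟹ the valuation form** (REF-B, abc-harv ref-2, 2026-08-27): apply abc with `ε/6` to the triple
`(a², b² − a², b²)` and use `rad(a²(b²−a²)b²) ≤ rad a · rad b · rad(b−a) · rad(a+b)`, `rad ≤ b⁶`:
`log(b−a) + log(a+b) ≤ ε·log b + log rad a + log rad b + log rad(b−a) + log rad(a+b) + C`. [folklore] -/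
theorem valuationForm_of_abc (h : _root_.ABC) (ε : ℝ) (hε : 0 < ε) :
    ∃ C : ℝ, ∀ a b : ℕ, 0 < a → a < b → Nat.Coprime a b →
      Real.log ((b - a : ℕ) : ℝ) + Real.log ((a + b : ℕ) : ℝ) ≤
        ε * Real.log (b : ℝ) + Real.log ((radical a : ℕ) : ℝ) + Real.log ((radical b : ℕ) : ℝ)
          + Real.log ((radical (b - a) : ℕ) : ℝ) + Real.log ((radical (a + b) : ℕ) : ℝ) + C := by
  obtain ⟨C, hC0, hC⟩ := ABC_iff.mp h (ε / 6) (by positivity)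
  refine ⟨Real.log C, fun a b ha hab hcop => ?_⟩
  have hab2 : a ^ 2 < b ^ 2 := Nat.pow_lt_pow_left hab two_ne_zero
  have hB : 0 < b ^ 2 - a ^ 2 := Nat.sub_pos_of_lt hab2
  have hsum : a ^ 2 + (b ^ 2 - a ^ 2) = b ^ 2 := Nat.add_sub_cancel' hab2.le
  have hcopT : Nat.Coprime (a ^ 2) (b ^ 2 - a ^ 2) := by
    have h2 : Nat.Coprime (a ^ 2) (b ^ 2) := Nat.Coprime.pow 2 2 hcop
    rw [← Nat.sub_add_cancel hab2.le] at h2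
    exact Nat.coprime_add_self_right.mp h2
  have hT : IsABCTriple (a ^ 2) (b ^ 2 - a ^ 2) (b ^ 2) := ⟨by positivity, hB, hsum, hcopT⟩
  have habc := hC _ _ _ hT
  rw [rad_def] at habc
  set R : ℕ := radical (a ^ 2 * (b ^ 2 - a ^ 2) * b ^ 2) with hR
  have hRpos : (0 : ℝ) < (R : ℝ) := by exact_mod_cast Nat.radical_pos _
  have hb : (0 : ℝ) < (b : ℝ) := by exact_mod_cast ha.trans hab
  have hBfac : b ^ 2 - a ^ 2 = (b + a) * (b - a) := Nat.sq_sub_sq b a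
  have hL : Real.log ((b - a : ℕ) : ℝ) + Real.log ((a + b : ℕ) : ℝ) =
      Real.log ((b ^ 2 - a ^ 2 : ℕ) : ℝ) := by
    rw [hBfac, Nat.cast_mul, Real.log_mul (by positivity) (by exact_mod_cast (by omega : b - a ≠ 0)),
      add_comm b a, add_comm]
  have hlog2 : Real.log ((b : ℝ) ^ 2) = 2 * Real.log (b : ℝ) := by
    rw [Real.log_pow]; norm_num
  have hBle : Real.log ((b ^ 2 - a ^ 2 : ℕ) : ℝ) ≤ 2 * Real.log (b : ℝ) := by
    rw [← hlog2, ← Nat.cast_pow]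
    exact Real.log_le_log (by exact_mod_cast hB) (by exact_mod_cast Nat.sub_le _ _)
  have h2 : 2 * Real.log (b : ℝ) < Real.log C + (1 + ε / 6) * Real.log (R : ℝ) := by
    have hRp : (0 : ℝ) < (R : ℝ) ^ (1 + ε / 6) := Real.rpow_pos_of_pos hRpos _
    have := Real.log_lt_log (by exact_mod_cast pow_pos (ha.trans hab) 2) habc
    rw [Nat.cast_pow, hlog2, Real.log_mul hC0.ne' hRp.ne', Real.log_rpow hRpos] at this
    exact this
  have h3 : Real.log (R : ℝ) ≤ 6 * Real.log (b : ℝ) := by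
    have hne : a ^ 2 * (b ^ 2 - a ^ 2) * b ^ 2 ≠ 0 :=
      Nat.mul_ne_zero (Nat.mul_ne_zero (pow_pos ha 2).ne' hB.ne') (pow_pos (ha.trans hab) 2).ne'
    have hle : R ≤ b ^ 6 := by
      refine (Nat.radical_le_self_iff.mpr hne).trans ?_
      calc a ^ 2 * (b ^ 2 - a ^ 2) * b ^ 2 ≤ b ^ 2 * b ^ 2 * b ^ 2 :=
            Nat.mul_le_mul (Nat.mul_le_mul hab2.le (Nat.sub_le _ _)) le_rfl
        _ = b ^ 6 := by ring
    have hlog6 : Real.log ((b : ℝ) ^ 6) = 6 * Real.log (b : ℝ) := by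
      rw [Real.log_pow]; norm_num
    rw [← hlog6]
    exact Real.log_le_log hRpos (by exact_mod_cast hle)
  have h4 : Real.log (R : ℝ) ≤ Real.log ((radical a : ℕ) : ℝ) + Real.log ((radical b : ℕ) : ℝ)
      + Real.log ((radical (b - a) : ℕ) : ℝ) + Real.log ((radical (a + b) : ℕ) : ℝ) := by
    have e1 := log_radical_mul_le (a ^ 2 * (b ^ 2 - a ^ 2)) (b ^ 2)
    have e2 := log_radical_mul_le (a ^ 2) (b ^ 2 - a ^ 2)
    have e3 : Real.log ((radical (b ^ 2 - a ^ 2) : ℕ) : ℝ) ≤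
        Real.log ((radical (b - a) : ℕ) : ℝ) + Real.log ((radical (a + b) : ℕ) : ℝ) := by
      rw [hBfac, add_comm b a, add_comm (Real.log _)]
      exact log_radical_mul_le (a + b) (b - a) |>.trans (le_of_eq (by ring))
    rw [radical_pow a two_ne_zero] at e2
    rw [radical_pow b two_ne_zero] at e1
    linarith
  have hε6 : (ε / 6) * Real.log (R : ℝ) ≤ ε * Real.log (b : ℝ) := by nlinarith
  linarith [hL, hBle, h2, h3, h4, hε6]

end Smirnov

open Smirnov in
/-- **abc ⟹ Smirnov** (row H-402, G-21; the direction NOT in print, REF-B 2026-08-27): the UPPER closed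
form plus the valuation form give `smirnovDefect a b ≤ (2 + ε) log b + (C − 1)`; divide by `log b > 0`.
Hence, with `abc_of_smirnovHurwitzInequality`, the door is a RESTATEMENT of abc. [folklore] -/
theorem smirnovHurwitzInequality_of_abc (h : _root_.ABC) : SmirnovHurwitzInequality := by
  intro ε hε
  obtain ⟨C, hC⟩ := valuationForm_of_abc h ε hε
  refine ⟨C - 1, fun a b ha hab hcop => ?_⟩
  have hb1 : (1 : ℝ) < b := by exact_mod_cast (show 1 < b by omega)
  have hlogb : 0 < Real.log (b : ℝ) := Real.log_pos hb1
  have hL : Real.log (b : ℝ) ≠ 0 := hlogb.ne'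
  have hup := smirnovDefect_le_closedForm ha hab
  have hR := hC a b ha hab hcop
  have hlogdiv : Real.log ((b : ℝ) / a) = Real.log (b : ℝ) - Real.log (a : ℝ) :=
    Real.log_div (by exact_mod_cast (show b ≠ 0 by omega)) (by exact_mod_cast ha.ne')
  have key : smirnovDefect a b ≤ (2 + ε) * Real.log (b : ℝ) + (C - 1) := by linarith
  calc smirnovDefect a b / Real.log (b : ℝ)
      ≤ ((2 + ε) * Real.log (b : ℝ) + (C - 1)) / Real.log (b : ℝ) :=
        div_le_div_of_nonneg_right key hlogb.le
    _ = 2 + ε + (C - 1) / Real.log (b : ℝ) := by field_simp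

/-- **Smirnov's Hurwitz inequality (Jarra transcription, `0 < q < 1`) ⟺ abc** — door C8 is a RESTATEMENT
of the summit (rung A0). abc is not proved by any of this. [folklore] -/
theorem smirnovHurwitzInequality_iff_abc : SmirnovHurwitzInequality ↔ _root_.ABC :=
  ⟨abc_of_smirnovHurwitzInequality, smirnovHurwitzInequality_of_abc⟩

end Summit.ABC.Harvest
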